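import Literature.MathematicalPhysics.QuantumLattice.HubbardFermiRadiusSmooth
import Mathlib.Analysis.Calculus.MeanValue
import Mathlib.Analysis.InnerProductSpace.PiL2
import Mathlib.Topology.Order.IntermediateValue
import HarnessLib

/-!
# The polar Fermi radius of the square-lattice band across the whole hole-doped band `-4 < μ < 0`

Topic `Literature/MathematicalPhysics/QuantumLattice`; continues `HubbardFermiRadius.lean` /
`HubbardFermiRadiusSmooth.lean`, which construct the polar parametrisation
`k = u(θ) (cos θ, sin θ)` of the Fermi curve `{ε = μ}` of `ε(k) = -2(cos k₁ + cos k₂)` only in the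
small-filling range `-4 < μ < -2 - √2` of Benfatto–Giuliani–Mastropietro (root `u ≤ π/2`, where
`ε` is convex). For every level in the lower half band `-4 < μ < 0` (all hole dopings of the
half-filled band, e.g. the Kohn–Luttinger window of Raghu–Kivelson–Scalapino 2010 §III) the Fermi
curve is still a closed curve around `Γ = 0`, star-shaped with respect to the origin, because the
dispersion is strictly increasing along every ray as long as the ray stays in the open square
`(-π, π)²`: `(d/dt) ε(t·dir θ) = 2(cos θ sin(t cos θ) + sin θ sin(t sin θ)) > 0` there
(`x sin x > 0` for `0 < |x| < π`), while on the boundary of the square `ε ≥ 0 > μ`.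

* `IsBandFermiRadius μ θ t` — `0 ≤ t`, `‖t · dir θ‖_∞ ≤ π` and `ε(t · dir θ) = μ`;
  `bandFermiRadius μ θ` — Hilbert's `ε` of it (the unique such `t` when `-4 < μ < 0`);
* `rayDispersionDt_pos_of_lt_exit` — radial strict monotonicity inside the square,
  `strictMonoOn_rayDispersion_band`;
* `existsUnique_isBandFermiRadius`, `sqDispersion_bandFermiRadius`, `bandFermiRadius_pos`,
  `norm_bandFermiRadius_smul_dir_lt` (the curve lies in the OPEN square), `bandFermiRadius_lt_exit`;
* `fermiPolar μ θ = u_μ(θ) (cos θ, sin θ) ∈ EuclideanSpace ℝ (Fin 2)` — the polar parametrisation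
  point (coordinates, norm, it lies in the open square); `bandFermiRadiusDeriv` (closed form
  `-∂_θF/∂_tF` of `u'`), `fermiPolarVelocity` (`u' dir θ + u dir^⊥ θ`, never zero) and
  `fermiPolarDOS = ‖γ'‖ / ‖∇ε(γ)‖` (positive) — the data of the change of variables to the angle.

Continuity, symmetries and smoothness are in `HubbardFermiRadiusBandContinuous.lean` and
`HubbardFermiRadiusBandSmooth.lean`. Everything is proved; the definitions are `IsBandFermiRadius`,
`bandFermiRadius`, `fermiPolar`, `bandFermiRadiusDeriv`, `fermiPolarVelocity`, `fermiPolarDOS`. [folklore]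

## Sources

Folklore (level sets of `cos k₁ + cos k₂`); the polar description is that of
G. Benfatto, A. Giuliani, V. Mastropietro, Ann. Henri Poincaré 7 (2006), §1 (1.4)–(1.5)
(`BenfattoGiulianiMastropietro2006`), here extended to the full range `-4 < μ < 0`; the range is the
one of S. Raghu, S. A. Kivelson, D. J. Scalapino, Phys. Rev. B 81 (2010) 224505, §III.
-/

noncomputable section

open Real Set Filter
open scoped Topology

namespace Literature.MathematicalPhysics.QuantumLattice

/-! ### The sup norm of a direction and the exit radius `π / ‖dir θ‖` -/

/-- `‖dir θ‖ = max |cos θ| |sin θ|` (sup norm on `Fin 2 → ℝ`). [folklore] -/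
theorem norm_dir (θ : ℝ) : ‖dir θ‖ = max |Real.cos θ| |Real.sin θ| := by
  rw [Pi.norm_def]
  simp [dir, Fin.univ_succ, Finset.sup_insert]

/-- `‖dir θ‖ > 0`. [folklore] -/
theorem norm_dir_pos (θ : ℝ) : 0 < ‖dir θ‖ := norm_pos_iff.2 (dir_ne_zero θ)

/-- `‖dir θ‖ ≤ 1`. [folklore] -/
theorem norm_dir_le_one (θ : ℝ) : ‖dir θ‖ ≤ 1 := by
  rw [norm_dir]
  exact max_le (Real.abs_cos_le_one θ) (Real.abs_sin_le_one θ)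

/-- `√2/2 ≤ ‖dir θ‖` (one of `|cos θ|, |sin θ|` is at least `√2/2`). [folklore] -/
theorem sqrt_two_div_two_le_norm_dir (θ : ℝ) : Real.sqrt 2 / 2 ≤ ‖dir θ‖ := by
  rw [norm_dir]
  have h1 := Real.sin_sq_add_cos_sq θ
  by_contra h
  have h' : max |Real.cos θ| |Real.sin θ| < Real.sqrt 2 / 2 := lt_of_not_ge h
  have hc : |Real.cos θ| < Real.sqrt 2 / 2 := (le_max_left _ _).trans_lt h'
  have hs : |Real.sin θ| < Real.sqrt 2 / 2 := (le_max_right _ _).trans_lt h'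
  have hc2 : Real.cos θ ^ 2 < 1 / 2 := by
    have := abs_nonneg (Real.cos θ)
    have h2 : |Real.cos θ| ^ 2 < (Real.sqrt 2 / 2) ^ 2 := by nlinarith
    rw [sq_abs] at h2
    have hsq : (Real.sqrt 2 / 2) ^ 2 = 1 / 2 := by
      rw [div_pow, Real.sq_sqrt (by norm_num)]; norm_num
    linarith
  have hs2 : Real.sin θ ^ 2 < 1 / 2 := by
    have := abs_nonneg (Real.sin θ)
    have h2 : |Real.sin θ| ^ 2 < (Real.sqrt 2 / 2) ^ 2 := by nlinarith
    rw [sq_abs] at h2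
    have hsq : (Real.sqrt 2 / 2) ^ 2 = 1 / 2 := by
      rw [div_pow, Real.sq_sqrt (by norm_num)]; norm_num
    linarith
  linarith

/-- The sup norm is continuous in the angle. [folklore] -/
theorem continuous_norm_dir : Continuous fun θ : ℝ => ‖dir θ‖ := by
  have : (fun θ : ℝ => ‖dir θ‖) = fun θ => max |Real.cos θ| |Real.sin θ| := funext norm_dir
  rw [this]
  fun_prop

/-- `‖t · dir θ‖ = t ‖dir θ‖` for `t ≥ 0`. [folklore] -/
theorem norm_smul_dir {t : ℝ} (ht : 0 ≤ t) (θ : ℝ) : ‖t • dir θ‖ = t * ‖dir θ‖ := by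
  rw [norm_smul, Real.norm_eq_abs, abs_of_nonneg ht]

/-- Coordinates are bounded by the sup norm: `|tdᵢ| ≤ ‖t · dir θ‖`. [folklore] -/
theorem abs_smul_dir_apply_le (t θ : ℝ) (i : Fin 2) : |(t • dir θ) i| ≤ ‖t • dir θ‖ := by
  have := norm_le_pi_norm (t • dir θ) i
  rwa [Real.norm_eq_abs] at this

/-! ### Radial monotonicity inside the open square -/

/-- `a · sin (t a) ≥ 0` whenever `t ≥ 0` and `|t a| ≤ π`. [folklore] -/
theorem mul_sin_mul_nonneg {a t : ℝ} (ht : 0 ≤ t) (h : |t * a| ≤ π) : 0 ≤ a * Real.sin (t * a) := by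
  rcases le_or_gt 0 a with ha | ha
  · have hta : 0 ≤ t * a := mul_nonneg ht ha
    exact mul_nonneg ha (Real.sin_nonneg_of_nonneg_of_le_pi hta (by rwa [abs_of_nonneg hta] at h))
  · have hta : t * a ≤ 0 := mul_nonpos_of_nonneg_of_nonpos ht ha.le
    have hsin : Real.sin (t * a) ≤ 0 :=
      Real.sin_nonpos_of_nonpos_of_neg_pi_le hta (by rw [abs_of_nonpos hta] at h; linarith)
    exact mul_nonneg_of_nonpos_of_nonpos ha.le hsin

/-- `a · sin (t a) > 0` whenever `t > 0`, `a ≠ 0` and `|t a| < π`. [folklore] -/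
theorem mul_sin_mul_pos {a t : ℝ} (ht : 0 < t) (ha : a ≠ 0) (h : |t * a| < π) :
    0 < a * Real.sin (t * a) := by
  rcases ha.lt_or_gt with ha | ha
  · have hta : t * a < 0 := mul_neg_of_pos_of_neg ht ha
    have hsin : Real.sin (t * a) < 0 := by
      rw [← neg_pos, ← Real.sin_neg]
      exact Real.sin_pos_of_pos_of_lt_pi (by linarith) (by rw [abs_of_neg hta] at h; linarith)
    exact mul_pos_of_neg_of_neg ha hsin
  · have hta : 0 < t * a := mul_pos ht ha
    exact mul_pos ha (Real.sin_pos_of_pos_of_lt_pi hta (by rwa [abs_of_pos hta] at h))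

/-- **Radial strict monotonicity inside the square**: `∂_t ε(t · dir θ) > 0` for `0 < t` with
`‖t · dir θ‖_∞ < π`. [folklore] -/
theorem rayDispersionDt_pos_of_lt_exit {θ t : ℝ} (ht : 0 < t) (h : t * ‖dir θ‖ < π) :
    0 < rayDispersionDt θ t := by
  have hc : |t * Real.cos θ| ≤ t * ‖dir θ‖ := by
    rw [abs_mul, abs_of_pos ht, norm_dir]
    exact mul_le_mul_of_nonneg_left (le_max_left _ _) ht.le
  have hs : |t * Real.sin θ| ≤ t * ‖dir θ‖ := by
    rw [abs_mul, abs_of_pos ht, norm_dir]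
    exact mul_le_mul_of_nonneg_left (le_max_right _ _) ht.le
  have hc0 : 0 ≤ Real.cos θ * Real.sin (t * Real.cos θ) := mul_sin_mul_nonneg ht.le (by linarith)
  have hs0 : 0 ≤ Real.sin θ * Real.sin (t * Real.sin θ) := mul_sin_mul_nonneg ht.le (by linarith)
  unfold rayDispersionDt
  -- the coordinate realising the sup norm is non-zero and gives a strictly positive term
  rcases le_total |Real.sin θ| |Real.cos θ| with hle | hle
  · have hmax : ‖dir θ‖ = |Real.cos θ| := by rw [norm_dir, max_eq_left hle]
    have hne : Real.cos θ ≠ 0 := by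
      intro h0; have := norm_dir_pos θ; rw [hmax, h0, abs_zero] at this; exact lt_irrefl _ this
    have hlt : |t * Real.cos θ| < π := by rwa [abs_mul, abs_of_pos ht, ← hmax]
    have := mul_sin_mul_pos ht hne hlt
    linarith
  · have hmax : ‖dir θ‖ = |Real.sin θ| := by rw [norm_dir, max_eq_right hle]
    have hne : Real.sin θ ≠ 0 := by
      intro h0; have := norm_dir_pos θ; rw [hmax, h0, abs_zero] at this; exact lt_irrefl _ this
    have hlt : |t * Real.sin θ| < π := by rwa [abs_mul, abs_of_pos ht, ← hmax]
    have := mul_sin_mul_pos ht hne hlt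
    linarith

/-- **`t ↦ ε(t · dir θ)` is strictly increasing on `[0, π / ‖dir θ‖]`** (the part of the ray in
the closed square). [folklore] -/
theorem strictMonoOn_rayDispersion_band (θ : ℝ) :
    StrictMonoOn (fun t : ℝ => rayDispersion (θ, t)) (Icc 0 (π / ‖dir θ‖)) := by
  have hn := norm_dir_pos θ
  refine strictMonoOn_of_deriv_pos (convex_Icc _ _)
    ((contDiff_rayDispersion (n := 1)).continuous.comp (Continuous.prodMk_right θ)).continuousOn
    fun t ht => ?_
  rw [interior_Icc] at ht
  rw [(hasDerivAt_rayDispersion_radius θ t).deriv]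
  exact rayDispersionDt_pos_of_lt_exit ht.1 (by rw [← lt_div_iff₀ hn]; exact ht.2)

/-- **At the exit point the dispersion is non-negative**: `ε((π/‖dir θ‖) · dir θ) ≥ 0` (the
coordinate realising the sup norm equals `±π`, where `cos = -1`). [folklore] -/
theorem rayDispersion_exit_nonneg (θ : ℝ) : 0 ≤ rayDispersion (θ, π / ‖dir θ‖) := by
  have hn := norm_dir_pos θ
  rw [rayDispersion_eq]
  simp only
  have hcos1 := Real.cos_le_one (π / ‖dir θ‖ * Real.cos θ)
  have hsin1 := Real.cos_le_one (π / ‖dir θ‖ * Real.sin θ)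
  rcases le_total |Real.sin θ| |Real.cos θ| with hle | hle
  · have hmax : ‖dir θ‖ = |Real.cos θ| := by rw [norm_dir, max_eq_left hle]
    have habs : |π / ‖dir θ‖ * Real.cos θ| = π := by
      rw [abs_mul, abs_div, abs_of_pos Real.pi_pos, abs_of_pos hn, ← hmax, div_mul_cancel₀ _ hn.ne']
    have hc : Real.cos (π / ‖dir θ‖ * Real.cos θ) = -1 := by
      rcases (abs_eq Real.pi_pos.le).1 habs with h | h
      · rw [h, Real.cos_pi]
      · rw [h, Real.cos_neg, Real.cos_pi]
    rw [hc]; linarith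
  · have hmax : ‖dir θ‖ = |Real.sin θ| := by rw [norm_dir, max_eq_right hle]
    have habs : |π / ‖dir θ‖ * Real.sin θ| = π := by
      rw [abs_mul, abs_div, abs_of_pos Real.pi_pos, abs_of_pos hn, ← hmax, div_mul_cancel₀ _ hn.ne']
    have hc : Real.cos (π / ‖dir θ‖ * Real.sin θ) = -1 := by
      rcases (abs_eq Real.pi_pos.le).1 habs with h | h
      · rw [h, Real.cos_pi]
      · rw [h, Real.cos_neg, Real.cos_pi]
    rw [hc]; linarith

/-! ### The band Fermi radius -/

/-- The defining property of the band Fermi radius along the ray of angle `θ`: a root of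
`ε(t · dir θ) = μ` with `t ≥ 0` in the closed square `‖t · dir θ‖_∞ ≤ π`. [folklore] -/
def IsBandFermiRadius (μ θ t : ℝ) : Prop := (0 ≤ t ∧ t * ‖dir θ‖ ≤ π) ∧ rayDispersion (θ, t) = μ

/-- Membership in the monotonicity interval. [folklore] -/
theorem IsBandFermiRadius.mem_Icc {μ θ t : ℝ} (h : IsBandFermiRadius μ θ t) :
    t ∈ Icc 0 (π / ‖dir θ‖) :=
  ⟨h.1.1, by rw [le_div_iff₀ (norm_dir_pos θ)]; exact h.1.2⟩

/-- **Existence and uniqueness of the band Fermi radius** along every ray, for every level in the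
lower half band `-4 < μ < 0`. [folklore] -/
theorem existsUnique_isBandFermiRadius {μ : ℝ} (hμ₁ : -4 < μ) (hμ₂ : μ < 0) (θ : ℝ) :
    ∃! t, IsBandFermiRadius μ θ t := by
  have hn := norm_dir_pos θ
  have hT : 0 < π / ‖dir θ‖ := div_pos Real.pi_pos hn
  have hcont : ContinuousOn (fun t : ℝ => rayDispersion (θ, t)) (Icc 0 (π / ‖dir θ‖)) :=
    ((contDiff_rayDispersion (n := 1)).continuous.comp (Continuous.prodMk_right θ)).continuousOn
  have h0 : rayDispersion (θ, 0) < μ := by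
    rw [rayDispersion_eq]; simp; linarith
  have h1 : μ < rayDispersion (θ, π / ‖dir θ‖) := hμ₂.trans_le (rayDispersion_exit_nonneg θ)
  obtain ⟨t, ht, hte⟩ : ∃ t ∈ Ioo 0 (π / ‖dir θ‖), rayDispersion (θ, t) = μ :=
    intermediate_value_Ioo hT.le hcont ⟨h0, h1⟩
  refine ⟨t, ⟨⟨ht.1.le, ?_⟩, hte⟩, ?_⟩
  · rw [← le_div_iff₀ hn]; exact ht.2.le
  · rintro s ⟨hs, hse⟩
    have hmono := strictMonoOn_rayDispersion_band θ
    have hsI : s ∈ Icc 0 (π / ‖dir θ‖) := ⟨hs.1, by rw [le_div_iff₀ hn]; exact hs.2⟩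
    exact hmono.injOn hsI ⟨ht.1.le, ht.2.le⟩ (hse.trans hte.symm)

/-- **The band Fermi radius `u_μ(θ)`**: the polar radius of the Fermi curve `{ε = μ}`,
`-4 < μ < 0`, along the ray of angle `θ` (Hilbert's `ε` of the defining property; unspecified
junk when `μ ∉ (-4, 0]`). [folklore] -/
def bandFermiRadius (μ θ : ℝ) : ℝ :=
  Classical.epsilon (IsBandFermiRadius μ θ)

section Band

variable {μ : ℝ} (hμ₁ : -4 < μ) (hμ₂ : μ < 0)
include hμ₁ hμ₂

/-- The band Fermi radius has the defining property. [folklore] -/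
theorem isBandFermiRadius_bandFermiRadius (θ : ℝ) : IsBandFermiRadius μ θ (bandFermiRadius μ θ) :=
  Classical.epsilon_spec (existsUnique_isBandFermiRadius hμ₁ hμ₂ θ).exists

/-- **`ε(u_μ(θ) · dir θ) = μ`**: the polar curve lies on the Fermi curve. [folklore] -/
theorem rayDispersion_bandFermiRadius (θ : ℝ) : rayDispersion (θ, bandFermiRadius μ θ) = μ :=
  (isBandFermiRadius_bandFermiRadius hμ₁ hμ₂ θ).2

/-- The same in terms of `sqDispersion`. [folklore] -/
theorem sqDispersion_bandFermiRadius (θ : ℝ) : sqDispersion (bandFermiRadius μ θ • dir θ) = μ :=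
  rayDispersion_bandFermiRadius hμ₁ hμ₂ θ

/-- Uniqueness: any admissible root is the band Fermi radius. [folklore] -/
theorem bandFermiRadius_unique {θ t : ℝ} (ht : IsBandFermiRadius μ θ t) : t = bandFermiRadius μ θ :=
  (existsUnique_isBandFermiRadius hμ₁ hμ₂ θ).unique ht (isBandFermiRadius_bandFermiRadius hμ₁ hμ₂ θ)

/-- `0 < u_μ(θ)`. [folklore] -/
theorem bandFermiRadius_pos (θ : ℝ) : 0 < bandFermiRadius μ θ := by
  rcases (isBandFermiRadius_bandFermiRadius hμ₁ hμ₂ θ).1.1.eq_or_lt with h | h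
  · have := rayDispersion_bandFermiRadius hμ₁ hμ₂ θ
    rw [← h, rayDispersion_eq] at this
    simp at this
    linarith
  · exact h

/-- `u_μ(θ) < π / ‖dir θ‖`: the root lies strictly before the exit point. [folklore] -/
theorem bandFermiRadius_lt_exit (θ : ℝ) : bandFermiRadius μ θ < π / ‖dir θ‖ := by
  have hu := isBandFermiRadius_bandFermiRadius hμ₁ hμ₂ θ
  rcases hu.mem_Icc.2.lt_or_eq with h | h
  · exact h
  · have := rayDispersion_exit_nonneg θ
    rw [← h, hu.2] at this
    linarith

/-- **The Fermi curve lies in the open square**: `‖u_μ(θ) · dir θ‖_∞ < π`. [folklore] -/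
theorem norm_bandFermiRadius_smul_dir_lt (θ : ℝ) : ‖bandFermiRadius μ θ • dir θ‖ < π := by
  rw [norm_smul_dir (bandFermiRadius_pos hμ₁ hμ₂ θ).le, ← lt_div_iff₀ (norm_dir_pos θ)]
  exact bandFermiRadius_lt_exit hμ₁ hμ₂ θ

/-- Coordinates of the Fermi point lie in `(-π, π)`. [folklore] -/
theorem abs_bandFermiRadius_mul_dir_lt (θ : ℝ) (i : Fin 2) : |bandFermiRadius μ θ * dir θ i| < π :=
  (abs_smul_dir_apply_le _ θ i).trans_lt (norm_bandFermiRadius_smul_dir_lt hμ₁ hμ₂ θ)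

/-- Transversality: `∂_t ε > 0` at the Fermi point. [folklore] -/
theorem rayDispersionDt_bandFermiRadius_pos (θ : ℝ) : 0 < rayDispersionDt θ (bandFermiRadius μ θ) :=
  rayDispersionDt_pos_of_lt_exit (bandFermiRadius_pos hμ₁ hμ₂ θ)
    (by rw [← lt_div_iff₀ (norm_dir_pos θ)]; exact bandFermiRadius_lt_exit hμ₁ hμ₂ θ)

end Band

/-! ### The polar parametrisation point -/

/-- **The polar parametrisation of the Fermi curve**: the point `u_μ(θ) (cos θ, sin θ)` of momentum
space `ℝ²` (Euclidean plane), for `-4 < μ < 0`. [cite: BenfattoGiulianiMastropietro2006, §1 (1.5)] -/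
def fermiPolar (μ θ : ℝ) : EuclideanSpace ℝ (Fin 2) :=
  WithLp.toLp 2 (bandFermiRadius μ θ • dir θ)

/-- Coordinates of the polar point: `(u cos θ, u sin θ)`. [folklore] -/
@[simp] theorem fermiPolar_apply_zero (μ θ : ℝ) : fermiPolar μ θ 0 = bandFermiRadius μ θ * Real.cos θ := by
  simp [fermiPolar]

/-- Coordinates of the polar point: `(u cos θ, u sin θ)`. [folklore] -/
@[simp] theorem fermiPolar_apply_one (μ θ : ℝ) : fermiPolar μ θ 1 = bandFermiRadius μ θ * Real.sin θ := by
  simp [fermiPolar]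

/-- `ofLp (fermiPolar μ θ) = u_μ(θ) • dir θ`. [folklore] -/
@[simp] theorem ofLp_fermiPolar (μ θ : ℝ) : WithLp.ofLp (fermiPolar μ θ) = bandFermiRadius μ θ • dir θ := rfl

section PolarBand

variable {μ : ℝ} (hμ₁ : -4 < μ) (hμ₂ : μ < 0)
include hμ₁ hμ₂

/-- The polar point lies on the Fermi curve: `ε(fermiPolar μ θ) = μ`. [folklore] -/
theorem sqDispersion_ofLp_fermiPolar (θ : ℝ) : sqDispersion (WithLp.ofLp (fermiPolar μ θ)) = μ :=
  sqDispersion_bandFermiRadius hμ₁ hμ₂ θ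

/-- The polar point lies in the open square `(-π, π)²`. [folklore] -/
theorem abs_fermiPolar_apply_lt (θ : ℝ) (i : Fin 2) : |fermiPolar μ θ i| < π := by
  have h := abs_bandFermiRadius_mul_dir_lt hμ₁ hμ₂ θ i
  fin_cases i <;> simpa using h

/-- The Euclidean norm of the polar point is the band Fermi radius. [folklore] -/
theorem norm_fermiPolar (θ : ℝ) : ‖fermiPolar μ θ‖ = bandFermiRadius μ θ := by
  rw [EuclideanSpace.norm_eq, Fin.sum_univ_two, fermiPolar_apply_zero, fermiPolar_apply_one]
  simp only [Real.norm_eq_abs, sq_abs]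
  have h : (bandFermiRadius μ θ * Real.cos θ) ^ 2 + (bandFermiRadius μ θ * Real.sin θ) ^ 2 =
      bandFermiRadius μ θ ^ 2 := by
    have := Real.cos_sq_add_sin_sq θ
    calc _ = bandFermiRadius μ θ ^ 2 * (Real.cos θ ^ 2 + Real.sin θ ^ 2) := by ring
      _ = _ := by rw [this, mul_one]
  rw [h, Real.sqrt_sq (bandFermiRadius_pos hμ₁ hμ₂ θ).le]

/-- The polar point is non-zero. [folklore] -/
theorem fermiPolar_ne_zero (θ : ℝ) : fermiPolar μ θ ≠ 0 := by
  intro h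
  have := norm_fermiPolar hμ₁ hμ₂ θ
  rw [h, norm_zero] at this
  exact (bandFermiRadius_pos hμ₁ hμ₂ θ).ne this

end PolarBand

/-! ### The angular derivative, the velocity and the density of states, in closed form -/

/-- **The angular derivative of the band Fermi radius in closed form**, `u'_μ(θ) = -∂_θF/∂_tF` at
`t = u_μ(θ)` (that this IS the derivative is `hasDerivAt_bandFermiRadius` in
`HubbardFermiRadiusBandSmooth.lean`). [folklore] -/
def bandFermiRadiusDeriv (μ θ : ℝ) : ℝ :=
  -rayDispersionDθ θ (bandFermiRadius μ θ) / rayDispersionDt θ (bandFermiRadius μ θ)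

/-- **The velocity of the polar parametrisation** `γ'(θ) = u' (cos θ, sin θ) + u (-sin θ, cos θ)`
(that this IS the derivative of `fermiPolar μ` is `hasDerivAt_fermiPolar` in `HubbardFermiPolar.lean`).
[cite: BenfattoGiulianiMastropietro2006, §1 (1.5)] -/
def fermiPolarVelocity (μ θ : ℝ) : EuclideanSpace ℝ (Fin 2) :=
  WithLp.toLp 2 (bandFermiRadiusDeriv μ θ • dir θ + bandFermiRadius μ θ • ![-Real.sin θ, Real.cos θ])

/-- **The density of states along the polar parametrisation**: `‖γ'(θ)‖ / ‖∇ε(γ(θ))‖` with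
`‖∇ε(k)‖ = 2 √(sin² k₀ + sin² k₁)` for `ε(k) = -2(cos k₀ + cos k₁)` — the density of the
Fermi-curve measure `dk̂ / v_F` of Raghu–Kivelson–Scalapino 2010 eq. (8) against `dθ` (proved in
`KohnLuttingerFermiCurvePolar.lean`). [cite: RaghuKivelsonScalapino2010, §II (8)] -/
def fermiPolarDOS (μ θ : ℝ) : ℝ :=
  ‖fermiPolarVelocity μ θ‖ /
    (2 * Real.sqrt (Real.sin (fermiPolar μ θ 0) ^ 2 + Real.sin (fermiPolar μ θ 1) ^ 2))


end Literature.MathematicalPhysics.QuantumLattice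

end
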